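import Mathlib
import Summits.PneNP.PneNP.Theses.OverlapGapAlgebra

/-!
# Sketch — crux-ideate stmt-PneNP-2462 (`NoStableSection`), ideator 1, round 1

First lemmas of the two idea cards (statements only; they must elaborate, not be proved):

* `BinomialConvexDomination` / `DartGameSmallBall` — card `binomial-extremal-dart-game`:
  Hoeffding's extremality (a `[0,1]`-valued i.i.d. sum is dominated in convex order by the binomial
  with the same mean) and its hockey-stick corollary `P[Σ X < 1] ≤ 2(1-p)^k + kp(1-p)^{k-1}`, the
  replacement for the Chernoff step (Prop. 5.7) of Bresler–Huang arXiv:2106.02129.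
* `WindowAtFive` — the numeric certificate that κ = 5 lies above the convex-order threshold with
  window `[2.3, 3.9]` and per-rung margin `0.45`.
* `LadderExtraction` — card `measurability-once-fubini-ladder`: the deterministic discrete-IVT
  extraction of a `(k+1)`-rung ladder (abstract form of BH Prop. 4.6 + Lemma 4.8).
-/

namespace Summit.PneNP.PneNP.Cruxes.NoStableSection.SketchIdeator1

open Finset

/-- Card 1, first lemma (finitary convex order / Hoeffding 1963 extremal step): for a finitely
supported law `w` on values `X i ∈ [0,1]` with mean `p = Σ w i * X i`, the `k`-fold i.i.d. sum is
dominated by `Bin(k,p)` on every convex test function. -/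
def BinomialConvexDomination : Prop :=
  ∀ (k N : ℕ) (w X : Fin N → ℝ) (φ : ℝ → ℝ), (∀ i, 0 ≤ w i) → ∑ i, w i = 1 →
    (∀ i, X i ∈ Set.Icc (0 : ℝ) 1) → ConvexOn ℝ Set.univ φ →
    ∑ ω : Fin k → Fin N, (∏ r, w (ω r)) * φ (∑ r, X (ω r)) ≤
      ∑ j ∈ range (k + 1), (k.choose j : ℝ) * (∑ i, w i * X i) ^ j *
        (1 - ∑ i, w i * X i) ^ (k - j) * φ j

/-- Card 1, the corollary actually consumed by the energy bound (test function `x ↦ (2 - x)₊`,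
which is convex, `≥ 1` on `(-∞, 1)` and vanishes on `Bin ≥ 2`): the small-ball probability of the
i.i.d. sum below `1` is at most `2(1-p)^k + k p (1-p)^{k-1}` (→ `(2+β)e^{-β}` for `kp = β`). -/
def DartGameSmallBall : Prop :=
  ∀ (k N : ℕ) (w X : Fin N → ℝ), (∀ i, 0 ≤ w i) → ∑ i, w i = 1 →
    (∀ i, X i ∈ Set.Icc (0 : ℝ) 1) →
    ∑ ω ∈ (univ : Finset (Fin k → Fin N)).filter (fun ω => ∑ r, X (ω r) < 1), ∏ r, w (ω r) ≤
      2 * (1 - ∑ i, w i * X i) ^ k + k * (∑ i, w i * X i) * (1 - ∑ i, w i * X i) ^ (k - 1)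

/-- Card 1, numeric certificate (cheapest falsifier, to be closed by `norm_num` + `Real.exp` bounds):
on the window `[2.3, 3.9]` the per-rung free-entropy margin at `κ = 5` with the convex-order
small-ball bound `(2+β)e^{-β}` is at least `0.45` (BH's Chernoff window `[3.30, 3.77]` gives `0.046`). -/
def WindowAtFive : Prop :=
  ∀ β ∈ Set.Icc (2.3 : ℝ) 3.9, β + 0.45 ≤ 5 * (1 - (2 + β) * Real.exp (-β))

/-- Card 2, first lemma (abstract ladder extraction = BH Prop. 4.6 with Lemma 4.8 folded into the
Lipschitz hypothesis): a potential `h L v` ("conditional overlap entropy of `v` given the rungs `L`")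
that vanishes on repeated points, moves by `≤ δ` per path step, and exceeds `bp` one window-length
`W` after the last rung (the `S_indep` input), admits `k` successive rungs inside `[bm, bp]`, each at
most `W` steps after the previous one, along a path of length `k * W`. Pure finite combinatorics. -/
def LadderExtraction : Prop :=
  ∀ (V : Type) (k W : ℕ) (x : ℕ → V) (h : List V → V → ℝ) (δ bm bp : ℝ),
    0 < W → 0 ≤ bm → δ ≤ bp - bm →
    (∀ (L : List V) (v : V), v ∈ L → h L v = 0) →
    (∀ (L : List V) (t : ℕ), t < k * W → |h L (x (t + 1)) - h L (x t)| ≤ δ) →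
    (∀ (ts : List ℕ) (t : ℕ), ts ≠ [] → ts.length ≤ k → (∀ s ∈ ts, s + W ≤ t) → t ≤ k * W →
        bp < h (ts.map x) (x t)) →
    ∃ t : ℕ → ℕ, t 0 = 0 ∧ (∀ ℓ < k, t ℓ < t (ℓ + 1) ∧ t (ℓ + 1) ≤ t ℓ + W) ∧
      ∀ ℓ < k, h ((List.range (ℓ + 1)).map fun i => x (t i)) (x (t (ℓ + 1))) ∈ Set.Icc bm bp

/-- Card 2, where measurability enters (the ONLY use of "x^t is a function of Φ^t"): the `S_indep`
first moment is uniform in the map `g` because, one sweep later, the instance is a function of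
literal coordinates disjoint from those read by the earlier outputs. Typed over the route's objects:
for every `g`, every list of at most `k` earlier splice points all at least one sweep (= `m*k` steps)
before `(r,q)`, the fraction of `Ψ` for which some `ν`-valid `y` for the instance at `(r,q)` has small
conditional type-entropy w.r.t. the earlier outputs is exponentially small — here only the SHAPE is
recorded, with the entropy functional abstracted as a parameter `Hc`. -/
def SweepDecorrelationShape (Hc : ∀ {n : ℕ}, List (Fin n → Bool) → (Fin n → Bool) → ℝ) : Prop :=
  ∃ k₀ : ℕ, ∀ k ≥ k₀, ∀ bp : ℝ, bp < 5 → ∃ ν : ℝ, 0 < ν ∧ ∃ c : ℝ, 0 < c ∧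
    ∀ᶠ n : ℕ in Filter.atTop, ∀ m : ℕ, m = ⌊5 * 2 ^ k * Real.log k / k * n⌋₊ →
    ∀ g : (Fin m → Fin k → Fin n × Bool) → (Fin n → Bool),
    ∀ (pts : List (Fin k × ℕ)) (r : Fin k) (q : ℕ), pts.length ≤ k → q ≤ m * k →
      (∀ p ∈ pts, p.2 ≤ m * k ∧ (p.1 : ℕ) * (m * k) + p.2 + m * k ≤ (r : ℕ) * (m * k) + q) →
      ((univ.filter fun Ψ : Fin (k + 1) → Fin m → Fin k → Fin n × Bool =>
          let P : Fin k → ℕ → Fin m → Fin k → Fin n × Bool := fun r q a b =>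
            if (a : ℕ) * k + b < q then Ψ r.succ a b else Ψ r.castSucc a b
          ∃ y : Fin n → Bool,
            ((univ.filter fun i : Fin m => ∀ j, y (P r q i j).1 ≠ (P r q i j).2).card : ℝ) ≤ ν * m ∧
            Hc (pts.map fun p => g (P p.1 p.2)) y ≤ bp * Real.log k / k).card : ℝ) ≤
        Real.exp (-(c * n)) * Fintype.card (Fin (k + 1) → Fin m → Fin k → Fin n × Bool)

/-- Path sanity (card 2, cheapest falsifier (a)): the typed splice map. -/
def splice {k m n : ℕ} (Ψ : Fin (k + 1) → Fin m → Fin k → Fin n × Bool) :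
    Fin k → ℕ → Fin m → Fin k → Fin n × Bool :=
  fun r q a b => if (a : ℕ) * k + b < q then Ψ r.succ a b else Ψ r.castSucc a b

/-- At splice offset `q = 0` the instance of sweep `r` is the array `Ψ r` (nothing resampled yet). -/
theorem splice_zero {k m n : ℕ} (Ψ : Fin (k + 1) → Fin m → Fin k → Fin n × Bool) (r : Fin k) :
    splice Ψ r 0 = Ψ r.castSucc := by
  funext a b
  simp [splice]

/-- At splice offset `q = m * k` the instance of sweep `r` is the array `Ψ (r+1)` (everything
resampled), i.e. the path is connected across sweeps: `splice Ψ r (m*k) = splice Ψ (r+1) 0`. -/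
theorem splice_full {k m n : ℕ} (Ψ : Fin (k + 1) → Fin m → Fin k → Fin n × Bool) (r : Fin k) :
    splice Ψ r (m * k) = Ψ r.succ := by
  funext a b
  have ha := a.isLt
  have hb := b.isLt
  have h : (a : ℕ) * k + b < m * k := by
    calc (a : ℕ) * k + b < (a : ℕ) * k + k := by omega
      _ = ((a : ℕ) + 1) * k := by ring
      _ ≤ m * k := Nat.mul_le_mul_right k ha
  simp [splice, h]

theorem splice_connected {k m n : ℕ} (Ψ : Fin (k + 1) → Fin m → Fin k → Fin n × Bool)
    (r : Fin k) (hr : (r : ℕ) + 1 < k) :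
    splice Ψ r (m * k) = splice Ψ ⟨r + 1, hr⟩ 0 := by
  rw [splice_full, splice_zero]
  congr 1

/-- One splice step changes at most one literal position: if `(a:ℕ)*k+b ≠ q` then the literal at
`(a,b)` is the same at offsets `q` and `q+1` (so consecutive instances differ in ≤ 1 literal, and a
clause slot `a` is "interrupted" at offset `q` iff `a*k < q < a*k+k`, at most one slot per offset). -/
theorem splice_succ_of_ne {k m n : ℕ} (Ψ : Fin (k + 1) → Fin m → Fin k → Fin n × Bool)
    (r : Fin k) (q : ℕ) (a : Fin m) (b : Fin k) (h : (a : ℕ) * k + b ≠ q) :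
    splice Ψ r (q + 1) a b = splice Ψ r q a b := by
  unfold splice
  by_cases h1 : (a : ℕ) * k + b < q
  · have h2 : (a : ℕ) * k + b < q + 1 := by omega
    simp [h1, h2]
  · have h2 : ¬ (a : ℕ) * k + b < q + 1 := by omega
    simp [h1, h2]

/-- Sanity: the crux we answer to, by name (its statement is the route's, never restated). -/
example : Prop := Summit.PneNP.PneNP.Theses.OverlapGapAlgebra.NoStableSection

end Summit.PneNP.PneNP.Cruxes.NoStableSection.SketchIdeator1
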